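import Summits.BirchSwinnertonDyer.Rank1Residual.X11b.KolyvaginReductionDatum
import HarnessLib

/-!
# K7t crux `UpperOffV0HSYPlus` (item 19804), line `offv0-kolyvagin2`, toward the `2`-adic local
# clause `h44`: McCallum's reduction datum at a SUPERSINGULAR Kolyvagin prime (`a_ℓ = 0`) — the
# «free-module» replacement of the cyclic-eigenspace step, for ANY prime `p` (so for `p = 2`)

Helper file of route `SylvesterTwoHeegnerIndex` (cell bsd-cm, rung K7t).  x11b3's
`KolyvaginH44.exists_reductionDatum` (`Rank1Residual/X11b/KolyvaginReductionDatum.lean`) builds, at a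
Kolyvagin prime `ℓ` of an ODD prime `p`, the reduction `red : E(K̄) → Ẽ(𝔽̄_ℓ)` modulo `𝔓 ∣ λ` with
its Frobenius `φ` and the finite-field conjuncts (`htors`, `hchar`, `hcyc`) of the tree's local
criterion; `p ≠ 2` (and the Weil pairing, `Frob(ℓ) = Frob(∞)`) enter ONLY through `hcyc` ("the
`Gal(K/ℚ)`-eigenspaces of `Ẽ(F_λ)` are cyclic", Gross (3.4)).  k7t-c2 g6's
`zsmul_kolyvaginClass_mem_selmerLocalKer_iff_of_isKolyvaginPrime_of_kerChi` consumes instead the single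
conjunct `hχ` : «`ker χ_ℓ = p^M Ẽ(F_λ)` on `{φ² = 1}`», `χ(c) = a'c − l'φ(c)`.  THIS FILE proves that
datum, with `hχ` at `a' = 0`, whenever **`a_ℓ(E) = 0`** — the case of EVERY Kolyvagin prime of the
Sylvester curves `E_p` at `2` (`ℓ ≡ 2 (mod 3)`, `j = 0`: tree
`frobeniusTrace_eq_zero_of_j_eq_zero_of_mod_three_eq_two`) — for ANY `p`, with NO image / pairing
hypothesis: by Manin's relation `φ² − a_ℓφ + ℓ = 0` on `Ẽ(𝔽̄_ℓ)` (tree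
`frobenius_frobenius_sub_trace_smul_add_card_smul`, Silverman V.2.3.1) `φ² = −ℓ`, so
`{φ² = 1} = Ẽ[ℓ+1]`; `χ = −l'φ` with `φ` injective; and `Ẽ(𝔽̄_ℓ) = red(E(K̄))` is divisible, whence
`Ẽ[l'] = p^M Ẽ[ℓ+1]` (`ℓ + 1 = p^M l'`).  This is memo STUB-AUDIT-19804 §2's «cyclic eigenspace →
free module» mechanism, in kernel form.

* `exists_reductionDatum_of_frobeniusTrace_eq_zero` — the reduction datum (`red` `I_𝔓`-invariant,
  `red ∘ F = φ² ∘ red`, `red` injective on `E[n]`, `φ² = 1` on `Ẽ[n]`) PLUS `hχ` at `a' = 0`, for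
  `W/ℚ` globally minimal, `ℓ ∤ Δ_W`, `a_ℓ(W) = 0`, `ℓ + 1 = p^M l'`, `λ` the unique place of `K` above
  `ℓ` with `q_λ = ℓ²`, `𝔓 ∣ λ`, `F` a Frobenius at `𝔓` fixing `E[n]` (`ℓ ∤ n ≠ 0`).

HONEST FRAMING: the reduction half is x11b3's proof verbatim (credited there); new is only the `hχ`
block.  What then remains of `h44` at `2` is `p`-free plumbing: the ring-class / Euler-system conjuncts
(`F P_m = P_m`, `I_𝔓 ↠ ⟨σ_ℓ⟩`, the root `R₀` with `a' = 0`) exactly as x11b3's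
`KolyvaginH44LocalizedCore` → `…Localized` → `…OfTraceRelation` → `…Concrete` supply them at odd `p`
(those files thread `p ≠ 2` only to reach the two lemmas replaced here and in `…LocalCriterionOfKerChi`).
No definition, no named fact, no `sorry`; B14 = O12 open as a class; BSD not claimed.
References: [McCallumLMS1991] Prop. 4.4 (proof); [GrossLMS1991] §3 (3.2)–(3.4), Prop. 6.2 (2);
[SilvermanAEC2009] V.2.3.1, VII.2.1, VII.3.1(b), VII.4.1; [Serre1972] §1.11.
-/

set_option autoImplicit false
set_option linter.dupNamespace false

noncomputable section

open scoped Classical Pointwise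
open WeierstrassCurve Field NumberField IsDedekindDomain
open Literature.NumberTheory.EllipticCurves Literature.NumberTheory.GaloisRepresentations
open Rat.HeightOneSpectrum
open Summit.BirchSwinnertonDyer.Rank1Residual.X11b.KolyvaginH44

universe u

namespace Summit.BirchSwinnertonDyer.BirchSwinnertonDyer.Theorems.SylvesterTwoUpper

variable {K : Type u} [Field K] [NumberField K]
  {ℓ : ℕ} [hℓ : Fact ℓ.Prime] (W : WeierstrassCurve ℚ) [W.IsGloballyMinimal] [W.IsElliptic]
  (hΔ : ¬ (ℓ : ℤ) ∣ minimalDiscriminantInt W)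

include hΔ in
/-- **McCallum's reduction datum at a supersingular Kolyvagin prime (`a_ℓ = 0`), with
«`ker χ_ℓ = p^M Ẽ(F_λ)`» — for ANY `p`, no image or pairing hypothesis.**  For `W/ℚ` globally minimal
and elliptic, a prime `ℓ ∤ Δ_W` with `a_ℓ(W) = 0`, naturals `p, M` and `l' ∈ ℤ` with `ℓ + 1 = p^M l'`,
the `ℓ`-power Frobenius `φ₀ ∈ Γ_{𝔽_ℓ}`, a place `v = λ` of the number field `K` which is the only
place above `ℓ` and has `q_λ = ℓ²`, a prime `𝔓 ∣ λ` of `\bar ℤ_K`, and an arithmetic Frobenius `F`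
at `𝔓` fixing `E[n]` (`ℓ ∤ n ≠ 0`): there are `g ∈ Γ_K`, `red = geomReduction ∘ g⁻¹` and `φ = φ₀`
with `red` `I_𝔓`-invariant, `red ∘ F = φ² ∘ red`, `red` injective on `E[n]`, `φ² = 1` on `Ẽ[n]`
(x11b3's `exists_reductionDatum`, reduction half, verbatim), and **for every `b` with `φ²b = b`:
`0·b − l'φ(b) = 0 ↔ ∃ y, φ²y = y ∧ p^M y = b`** (Manin `φ² = −ℓ` since `a_ℓ = 0`, so `{φ² = 1} = Ẽ[ℓ+1]`;
`φ` injective; `Ẽ(𝔽̄_ℓ) = red(E(K̄))` divisible). [cite: McCallumLMS1991, Prop. 4.4 (proof)]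
[cite: GrossLMS1991, Prop. 6.2 (2)] [cite: SilvermanAEC2009, Thm. V.2.3.1, Prop. VII.2.1, VII.3.1(b), VII.4.1] -/
theorem exists_reductionDatum_of_frobeniusTrace_eq_zero {p M : ℕ} {l' : ℤ}
    (hl' : ((ℓ + 1 : ℕ) : ℤ) = (p : ℤ) ^ M * l') (ha0 : W.frobeniusTrace ℓ = 0)
    {φ₀ : absoluteGaloisGroup (ZMod ℓ)} (hφ : ∀ x : AlgebraicClosure (ZMod ℓ), φ₀ • x = x ^ ℓ)
    {v : HeightOneSpectrum (𝓞 K)} (hv : (ℓ : 𝓞 K) ∈ v.asIdeal)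
    (huniq : ∀ w : HeightOneSpectrum (𝓞 K), (ℓ : 𝓞 K) ∈ w.asIdeal → w = v)
    (hres : v.residueCard = ℓ ^ 2)
    {𝔓 : Ideal (absIntegers (𝓞 K) K)} (h𝔓 : 𝔓 ∈ v.primesAbove)
    {n : ℕ} (hn : ¬ ℓ ∣ n) (hn0 : n ≠ 0) {F : absoluteGaloisGroup K}
    (hF : IsArithFrobAt (𝓞 K) F 𝔓) (hFfix : F ∈ torsionFixing (W.baseChange K) (n : ℤ)) :
    ∃ (g : absoluteGaloisGroup K)
      (red : geomPoints (W.baseChange K) →+ (reductionModPrime W ℓ).geomPoints)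
      (φ : (reductionModPrime W ℓ).geomPoints →+ (reductionModPrime W ℓ).geomPoints),
      (∀ x, red x = geomReduction hΔ ((RatClosure.pointsEquiv (K := K) W).symm (g⁻¹ • x))) ∧
      (∀ b, φ b = φ₀ • b) ∧
      (∀ τ ∈ 𝔓.inertia (absoluteGaloisGroup K), ∀ x, red (τ • x) = red x) ∧
      (∀ x, red (F • x) = φ (φ (red x))) ∧
      (∀ x, (n : ℤ) • x = 0 → red x = 0 → x = 0) ∧
      (∀ b, (n : ℤ) • b = 0 → φ (φ b) = b) ∧
      (∀ b, φ (φ b) = b →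
        ((0 : ℤ) • b - l' • φ b = 0 ↔ ∃ y, φ (φ y) = y ∧ ((p : ℤ) ^ M) • y = b)) := by
  haveI : (reductionModPrime W ℓ).IsElliptic := isElliptic_reductionModPrime W hΔ
  set θ := RatClosure.pointsEquiv (K := K) W with hθ
  -- the place `v₀ = (ℓ)` of `ℚ`, the prime `𝔓₀ = 𝔓 ∩ \bar ℤ`, the prime `𝔓pl` of the place
  obtain ⟨v₀, hv₀, hℓv₀⟩ := exists_ratPlace ℓ
  haveI := v.isPrime
  have hw : v.asIdeal.under (𝓞 ℚ) = v₀.asIdeal :=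
    Rat.under_eq_asIdeal_of_natCast_mem hℓ.out hℓv₀ hv
  set 𝔓₀ : Ideal (absIntegers (𝓞 ℚ) ℚ) := 𝔓.comap (absIntegersMap ℚ K) with h𝔓₀def
  have h𝔓₀ : 𝔓₀ ∈ v₀.primesAbove := comap_absIntegersMap_mem_primesAbove hw h𝔓
  obtain ⟨𝔓pl, hmem, h𝔓pl⟩ := exists_ideal_placeOver ℓ hv₀
  -- a `g ∈ Γ_K` with `res g • 𝔓pl = 𝔓₀` (transitivity of `Γ_K` on the primes above the inert `λ`)
  obtain ⟨𝔔, w, h𝔔c, hwv₀, h𝔔w⟩ := exists_place_comap_eq_smul (M := K) h𝔓pl 1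
  rw [one_smul] at h𝔔c
  have hwv : w = v := by
    refine huniq w ?_
    haveI := w.isPrime
    have : (ℓ : 𝓞 ℚ) ∈ w.asIdeal.under (𝓞 ℚ) := by rw [hwv₀]; exact hℓv₀
    rw [Ideal.under_def, Ideal.mem_comap, map_natCast] at this
    exact this
  subst hwv
  obtain ⟨g, hg⟩ := HeightOneSpectrum.exists_smul_eq_of_mem_primesAbove_holds h𝔔w h𝔓
  have hδ : absGaloisRestrict ℚ K g • 𝔓pl = 𝔓₀ := by
    rw [← h𝔔c, ← comap_absIntegersMap_smul, hg]
  -- the reduction along `𝔓₀`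
  obtain ⟨hI, hFr, hinj, hsurj₀⟩ := geomReduction_conj_datum hΔ hv₀ hmem h𝔓pl hδ hφ
  set red₀ : W.geomPoints →+ (reductionModPrime W ℓ).geomPoints :=
    (geomReduction hΔ).comp (DistribSMul.toAddMonoidHom W.geomPoints (absGaloisRestrict ℚ K g)⁻¹)
    with hred₀def
  have hred₀ : ∀ P, red₀ P = geomReduction hΔ ((absGaloisRestrict ℚ K g)⁻¹ • P) := fun P ↦ rfl
  set red : geomPoints (W.baseChange K) →+ (reductionModPrime W ℓ).geomPoints :=
    red₀.comp θ.symm.toAddMonoidHom with hreddef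
  have hred : ∀ Q, red Q = red₀ (θ.symm Q) := fun Q ↦ rfl
  set Φ : (reductionModPrime W ℓ).geomPoints →+ (reductionModPrime W ℓ).geomPoints :=
    DistribSMul.toAddMonoidHom _ φ₀ with hΦdef
  have hΦ : ∀ b, Φ b = φ₀ • b := fun b ↦ rfl
  -- ### `red ∘ F = φ² ∘ red`
  have hredF : ∀ x, red (F • x) = Φ (Φ (red x)) := by
    have hF' : ∀ x : absIntegers (𝓞 ℚ) ℚ,
        absGaloisRestrict ℚ K F • x - x ^ (ℓ ^ 2) ∈ 𝔓₀ := by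
      rw [forall_smul_sub_pow_mem_comap_iff ℚ K 𝔓 F (ℓ ^ 2), ← hres]
      exact (HeightOneSpectrum.isArithFrobAt_iff_of_mem_primesAbove h𝔓 F).mp hF
    obtain ⟨h', hh'⟩ := HeightOneSpectrum.exists_isArithFrobAt_of_mem_primesAbove_holds h𝔓₀
    have hq : v₀.residueCard = ℓ := by
      rw [Rat.residueCard_eq_natGenerator]; exact hv₀
    have hpow : ∀ x : absIntegers (𝓞 ℚ) ℚ, h' ^ 2 • x - x ^ (ℓ ^ 2) ∈ 𝔓₀ := fun x ↦ by
      have := smul_pow_sub_pow_mem_of_isArithFrobAt h𝔓₀ hh' 2 x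
      rwa [hq] at this
    set ι : absoluteGaloisGroup ℚ := absGaloisRestrict ℚ K F * (h' ^ 2)⁻¹ with hι
    have hιI : ι ∈ 𝔓₀.inertia (absoluteGaloisGroup ℚ) := by
      intro x
      change ι • x - x ∈ 𝔓₀
      set y := (h' ^ 2)⁻¹ • x with hy
      have hx : x = h' ^ 2 • y := by rw [hy, smul_inv_smul]
      have h1 : ι • x = absGaloisRestrict ℚ K F • y := by rw [hι, mul_smul]
      rw [h1, hx]
      have := sub_mem (hF' y) (hpow y)
      rwa [sub_sub_sub_cancel_right] at this
    have hιh : ι * h' ^ 2 = absGaloisRestrict ℚ K F := by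
      rw [hι, mul_assoc, inv_mul_cancel, mul_one]
    intro x
    rw [hred, hred, pointsEquiv_symm_smul, ← hιh, mul_smul, hI ι hιI, pow_two, mul_smul,
      hFr h' hh', hFr h' hh', hΦ, hΦ]
  -- ### Manin's relation with `a_ℓ = 0`: `φ² = −ℓ` on all of `Ẽ(𝔽̄_ℓ)`, so `{φ² = 1} = Ẽ[ℓ+1]`
  have hcard : Nat.card (ZMod ℓ) = ℓ := Nat.card_zmod ℓ
  have hφ' : ∀ x : AlgebraicClosure (ZMod ℓ), φ₀ • x = x ^ Nat.card (ZMod ℓ) := by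
    rw [hcard]; exact hφ
  have hManin : ∀ b : (reductionModPrime W ℓ).geomPoints, Φ (Φ b) + (ℓ : ℤ) • b = 0 := by
    intro b
    have h := (reductionModPrime W ℓ).frobenius_frobenius_sub_trace_smul_add_card_smul hφ' b
    rw [hcard, ← frobeniusTrace_eq_sub_natCard_reductionModPrime W ℓ, ha0, zero_smul,
      sub_zero] at h
    rw [hΦ, hΦ]
    exact_mod_cast h
  have hfix_iff : ∀ b : (reductionModPrime W ℓ).geomPoints,
      Φ (Φ b) = b ↔ ((ℓ + 1 : ℕ) : ℤ) • b = 0 := by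
    intro b
    have h := hManin b
    have hsplit : ((ℓ + 1 : ℕ) : ℤ) • b = (ℓ : ℤ) • b + b := by
      rw [Nat.cast_add, Nat.cast_one, add_smul, one_smul]
    constructor
    · intro hb
      rw [hb, add_comm] at h
      rwa [hsplit]
    · intro hb
      rw [hsplit] at hb
      -- `φ²b = −ℓ b = b`
      have h1 : Φ (Φ b) = -((ℓ : ℤ) • b) := eq_neg_of_add_eq_zero_left h
      have h2 : b = -((ℓ : ℤ) • b) := eq_neg_of_add_eq_zero_left (by rw [add_comm]; exact hb)
      rw [h1, ← h2]
  -- ### `red` is onto (`geomReduction` is) and `E(K̄)` is divisible, so `Ẽ(𝔽̄_ℓ)` is divisible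
  have hsurj : Function.Surjective red := by
    intro b
    obtain ⟨P, hP⟩ := hsurj₀ b
    exact ⟨θ P, by rw [hred, AddEquiv.symm_apply_apply]; exact hP⟩
  have hpM0 : ((p : ℤ) ^ M) ≠ 0 := by
    intro h0
    have : ((ℓ + 1 : ℕ) : ℤ) = 0 := by rw [hl', h0, zero_mul]
    exact absurd this (by exact_mod_cast Nat.succ_ne_zero ℓ)
  have hdivB : ∀ b : (reductionModPrime W ℓ).geomPoints, ∃ y, ((p : ℤ) ^ M) • y = b := by
    intro b
    obtain ⟨x, rfl⟩ := hsurj b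
    obtain ⟨y, hy⟩ := (W.baseChange K).zsmul_geomPoints_surjective_of_charZero hpM0 x
    exact ⟨red y, by rw [← map_zsmul]; exact congrArg red hy⟩
  have hΦinj : Function.Injective Φ := fun a b h ↦ by
    rw [hΦ, hΦ] at h
    exact MulAction.injective φ₀ h
  refine ⟨g, red, Φ, fun x ↦ ?_, fun b ↦ rfl, ?_, hredF, ?_, ?_, ?_⟩
  · rw [hred, hred₀, pointsEquiv_symm_smul, map_inv]
  · -- inertia
    intro τ hτ x
    rw [hred, hred, pointsEquiv_symm_smul]
    exact hI _ (absGaloisRestrict_mem_inertia_comap ℚ K hτ) _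
  · -- injective on `E[n]`
    intro x hx h0
    rw [hred] at h0
    have hx' : n • θ.symm x = 0 := by rw [← natCast_zsmul, ← map_zsmul, hx, map_zero]
    have := hinj n hn _ hx' h0
    rw [← θ.symm.map_eq_zero_iff]
    exact this
  · -- `φ² = 1` on `B[n]`
    intro b hb
    obtain ⟨P₀, hP₀, rfl⟩ := exists_torsion_lift W hΔ hinj hn hn0 b hb
    set Q : geomPoints (W.baseChange K) := θ P₀ with hQdef
    have hQn : Q ∈ geomTorsion (W.baseChange K) (n : ℤ) := by
      rw [mem_geomTorsion_iff, hQdef, ← map_zsmul, hP₀, map_zero]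
    have hFQ : F • Q = Q :=
      congrArg Subtype.val (((mem_torsionFixing_iff (W.baseChange K) (n : ℤ)).mp hFfix) ⟨Q, hQn⟩)
    have hQred : red Q = red₀ P₀ := by rw [hred, hQdef, AddEquiv.symm_apply_apply]
    rw [← hQred, ← hredF, hFQ]
  · -- ### `ker χ_ℓ = p^M Ẽ(F_λ)` on `{φ² = 1} = Ẽ[ℓ+1]`, `χ = −l'φ`
    intro b hb
    constructor
    · intro h0
      rw [zero_smul, zero_sub, neg_eq_zero, ← map_zsmul] at h0
      have hl'b : l' • b = 0 := hΦinj (by rw [h0, map_zero])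
      obtain ⟨y, hy⟩ := hdivB b
      refine ⟨y, (hfix_iff y).mpr ?_, hy⟩
      rw [hl', mul_comm, mul_smul, hy, hl'b]
    · rintro ⟨y, hy, hyb⟩
      have hy0 : ((ℓ + 1 : ℕ) : ℤ) • y = 0 := (hfix_iff y).mp hy
      rw [zero_smul, zero_sub, neg_eq_zero, ← map_zsmul, ← hyb, smul_smul, mul_comm, ← hl', hy0,
        map_zero]

end Summit.BirchSwinnertonDyer.BirchSwinnertonDyer.Theorems.SylvesterTwoUpper

end
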